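import Summits.QuantumAdvantage.QuantumAdvantage.Theorems.SteerDialAffineLemmas

/-!
# SteerDial (13): SteerDialAffine — the covering dichotomy DECIDED on the affine-system family

Part 13b (assembly; lemmas in part 13a `SteerDialAffineLemmas`) of the prover-side twin of the lineage decomp-qadv-lens-5 steering programme, generation 9, workshop node
«TagDial» rev 5 §9–§10.  The re-typed residual of item 30909 is `InvCover3 ∧ InvModCover3` (part 11,
`steerDial_algCover3_of_inv`); the strategy-free dichotomy `InvModCover3` («modulo a rotation-invariant dense
polylog-degree body event of the certifier's choosing, a certified polylog rotation list covers all but `2ⁿ/n^{k'}`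
bodies of every dense polylog-degree event») is FALSE without the invariant factor (part 12 / the critic's certificate:
class-weight tests) and is here PROVED on the AFFINE-SYSTEM FAMILY `ψ := 1 − [E](x|_{[0,n)})`, `E ⊆ {0,1}ⁿ` cut out by
`S ≤ (log₂ n)^c` affine forms over `𝔽₃` — the family containing every adversary on record (class weights, weight
residues, periodic profiles, planted tags and their intersections): `steerDial_invModCover3Affine`.
Proof = a column/recurrence DICHOTOMY for the rotated system `{ℓ_s(rot^t y) = b_s : s < S, t < T}`, `T = (k'+1)(L+1)`,
`L = log₂ n`: `cols_dichotomy` (rank-free, via `exists_linearIndependent'` + `Submodule.exists_le_ker_of_lt_top`) gives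
EITHER `T` coordinates carrying linearly independent columns — then LEMMA R `card_solSet_mul_le` (restriction off those
coordinates is injective on each fibre; junta product bounds of part 10) bounds the bodies whose first `T` rotations stay
in `E` by `2^{n−T} ≤ 2ⁿ/n^{k'}`, with `φ := 1` — OR a non-trivial vanishing ROW combination — then the row recurrence
(`propagate_of_rec`, `rotSys_all`, `rotSys_invariant`) makes `Z = {y : ∀ s, ∀ t < T, ℓ_s(rot^t y) = b_s}` rotation
invariant, of degree `≤ 2·S·T ≤ L^{c+3}` (`prod_one_sub_sq`) and of size `≤ #E ≤ η_I·2ⁿ`, and `φ := 1 − 1_Z` leaves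
`Bad = ∅`.  What remains undecided of the workshop hinge: non-linear polylog-degree body events and window-reading
tests.  No `def … : Prop`, no `instance`, no `notation`.
-/

set_option linter.style.longLine false
set_option linter.dupNamespace false

namespace Summit.QuantumAdvantage.QuantumAdvantage.Theorems.SteerDial

open Finset
open Literature.Computability.QuantumComplexity Literature.Computability.MetaComplexity
open Literature.Computability.QuantumComplexity.RingHLF
open Summit.QuantumAdvantage.AdviceFreeQNC0
open Summit.QuantumAdvantage.QuantumAdvantage.Theses

section AffineCore

variable {n : ℕ}

/-- Degree one (PROVED): a rotated affine form minus its constant lies in `lowDeg 1`. -/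
theorem lform_rot_sub_mem_lowDeg (c : Fin n → ZMod 3) (t : ℕ) (b : ZMod 3) :
    (fun y => lform c (rot t y) - b : Smolensky.CubeFn (ZMod 3) n) ∈ Smolensky.lowDeg (ZMod 3) n 1 := by
  have h1 : (fun y => lform c (rot t y) - b : Smolensky.CubeFn (ZMod 3) n) =
      (∑ i, rotCoef c t i • Smolensky.mono (ZMod 3) {i}) - b • (1 : Smolensky.CubeFn (ZMod 3) n) := by
    funext y
    simp only [lform_rot_eq, Pi.sub_apply, Finset.sum_apply, Pi.smul_apply, smul_eq_mul,
      Smolensky.mono_apply, Finset.mem_singleton, forall_eq, Pi.one_apply, mul_one]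
  rw [h1]
  exact Submodule.sub_mem _
    (Submodule.sum_mem _ fun i _ => Submodule.smul_mem _ _ (Smolensky.mono_mem_lowDeg (by simp)))
    (Submodule.smul_mem _ _ (Smolensky.one_mem_lowDeg _))

/-- Degree two (PROVED): the indicator factor `1 − (ℓ_c(rot t y) − b)²`. -/
theorem indFactor_mem_lowDeg (c : Fin n → ZMod 3) (t : ℕ) (b : ZMod 3) :
    (fun y => 1 - (lform c (rot t y) - b) ^ 2 : Smolensky.CubeFn (ZMod 3) n) ∈
      Smolensky.lowDeg (ZMod 3) n 2 := by
  have h := lform_rot_sub_mem_lowDeg c t b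
  have h2 := Smolensky.mul_mem_lowDeg_add h h
  have e : (fun y => 1 - (lform c (rot t y) - b) ^ 2 : Smolensky.CubeFn (ZMod 3) n) =
      1 - (fun y => lform c (rot t y) - b : Smolensky.CubeFn (ZMod 3) n) *
        (fun y => lform c (rot t y) - b) := by
    funext y
    simp [sq]
  rw [e]
  exact Submodule.sub_mem _ (Smolensky.one_mem_lowDeg _) h2

/-- **`InvModCover3` DECIDED on the affine-system family, body-level core (PROVED; critic row 60v3 test (a)).**
For every sparse body event `E = {y : ℓ_s(y) = b_s ∀ s}` cut out by `S ≤ (log₂ n)^{c₀}` affine forms over `𝔽₃`,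
consecutive rotations `t < T`, `1 ≤ T ≤ (log₂ n)²`, admit a ROTATION-INVARIANT `φ` of degree `≤ (log₂ n)^{c₀+3}` with
`#{φ = 1} ≥ (1 − η_I)·2ⁿ` (given `#E ≤ η_I·2ⁿ`) and `#({φ = 1} ∩ {y : rot t y ∈ E ∀ t < T}) ≤ 2ⁿ/n^{k'}`:
CASE A (some form has `T` coordinates with independent rotated columns) by LEMMA R with `φ := 1`; CASE B (every
form has a rotated-row relation) with `φ := 1 − Π_s Π_{t<T} (1 − (ℓ_s(rot t y) − b_s)²)`, whose zero set is the
rotation-invariant solution set (`rotSys_invariant`) and misses nothing of `Bad`.  The window/`pad`/`wordCert`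
plumbing of `InvModCover3` (body-only `ψ = 1 − [E](x|_{[0,n)})`, words `W0`) is not repeated here. -/
theorem invModCover3_affineCore (ηI : ℝ) (k' c₀ : ℕ) :
    ∃ n₀ : ℕ, ∀ n ≥ n₀, ∀ S : ℕ, S ≤ (Nat.log 2 n) ^ c₀ →
    ∀ (cf : Fin S → Fin n → ZMod 3) (bv : Fin S → ZMod 3) (E : Finset (Fin n → Bool)),
    (∀ y, y ∈ E ↔ ∀ s, lform (cf s) y = bv s) → (E.card : ℝ) ≤ ηI * 2 ^ n →
    ∃ T : ℕ, 1 ≤ T ∧ T ≤ (Nat.log 2 n) ^ 2 ∧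
      ∃ φ : Smolensky.CubeFn (ZMod 3) n, φ ∈ Smolensky.lowDeg (ZMod 3) n ((Nat.log 2 n) ^ (c₀ + 3)) ∧
      (∀ y, φ (rot 1 y) = φ y) ∧
      (1 - ηI) * (2 : ℝ) ^ n ≤ ((univ.filter fun y : Fin n → Bool => φ y = 1).card : ℝ) ∧
      ((univ.filter fun y : Fin n → Bool => φ y = 1 ∧ ∀ t < T, rot t y ∈ E).card : ℝ) ≤
        1 / (n : ℝ) ^ k' * (2 : ℝ) ^ n := by
  classical
  refine ⟨2 ^ (k' + 3), ?_⟩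
  intro n hn S hS cf bv E hEdef hE
  set L := Nat.log 2 n with hL
  have hLk : k' + 3 ≤ L := by rw [hL]; exact Nat.le_log_of_pow_le (by norm_num) hn
  have hn1 : 1 ≤ n := le_trans Nat.one_le_two_pow hn
  set T := (k' + 1) * (L + 1) with hT
  have hT1 : 1 ≤ T := by rw [hT]; exact Nat.le_of_lt_succ (by nlinarith)
  have hTL : T ≤ L ^ 2 := by rw [hT]; nlinarith [hLk]
  have hnT : n ^ k' ≤ 2 ^ T := by
    have hnL : n < 2 ^ (L + 1) := by rw [hL]; exact Nat.lt_pow_succ_log_self (by norm_num) n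
    calc n ^ k' ≤ (2 ^ (L + 1)) ^ k' := Nat.pow_le_pow_left hnL.le k'
      _ = 2 ^ ((L + 1) * k') := by rw [← pow_mul]
      _ ≤ 2 ^ T := Nat.pow_le_pow_right (by norm_num) (by rw [hT]; nlinarith)
  have hu : ((univ : Finset (Fin n → Bool)).card : ℝ) = (2 : ℝ) ^ n := by simp
  have hnpos : (0 : ℝ) < (n : ℝ) ^ k' := by
    have : (0 : ℝ) < n := by exact_mod_cast hn1
    positivity
  have h2pos : (0 : ℝ) < (2 : ℝ) ^ n := by positivity
  refine ⟨T, hT1, hTL, ?_⟩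
  set M : Fin S → Fin T → Fin n → ZMod 3 := fun s t i => rotCoef (cf s) t.val i with hM
  by_cases hA : ∃ s : Fin S, ∃ J : Fin T → Fin n, Function.Injective J ∧
      LinearIndependent (ZMod 3) (fun t : Fin T => fun t' : Fin T => M s t' (J t))
  · -- CASE A (pseudorandom): φ := 1, the bad set is small by LEMMA R
    obtain ⟨s₀, J, hJ, hli⟩ := hA
    refine ⟨1, Smolensky.one_mem_lowDeg _, fun y => rfl, ?_, ?_⟩
    · have h1 : (univ.filter fun y : Fin n → Bool => (1 : Smolensky.CubeFn (ZMod 3) n) y = 1) = univ := by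
        apply Finset.filter_true_of_mem
        intro y _
        rfl
      rw [h1, hu]
      nlinarith
    · have hsub : (univ.filter fun y : Fin n → Bool =>
          (1 : Smolensky.CubeFn (ZMod 3) n) y = 1 ∧ ∀ t < T, rot t y ∈ E) ⊆ solSet (M s₀) (fun _ => bv s₀) := by
        intro y hy
        simp only [mem_filter, mem_univ, true_and] at hy
        simp only [solSet, mem_filter, mem_univ, true_and]
        intro t
        have h := (hEdef _).mp (hy.2 t.val t.is_lt) s₀
        rw [lform_rot_eq] at h
        simpa [hM] using h
      have h1 := card_solSet_mul_le (M s₀) (fun _ => bv s₀) J hJ hli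
      have h2 : (univ.filter fun y : Fin n → Bool =>
          (1 : Smolensky.CubeFn (ZMod 3) n) y = 1 ∧ ∀ t < T, rot t y ∈ E).card * n ^ k' ≤ 2 ^ n :=
        le_trans (Nat.mul_le_mul (Finset.card_le_card hsub) hnT) h1
      have h3 : ((univ.filter fun y : Fin n → Bool =>
          (1 : Smolensky.CubeFn (ZMod 3) n) y = 1 ∧ ∀ t < T, rot t y ∈ E).card : ℝ) * (n : ℝ) ^ k' ≤
          (2 : ℝ) ^ n := by exact_mod_cast h2
      rw [one_div, inv_mul_eq_div, le_div_iff₀ hnpos]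
      exact h3
  · -- CASE B (structured): every form has a rotated-row relation
    have hB : ∀ s : Fin S, ∃ lam : Fin T → ZMod 3, lam ≠ 0 ∧ ∀ i, ∑ t, lam t * M s t i = 0 :=
      fun s => (cols_dichotomy (M s)).resolve_left fun h => hA ⟨s, h⟩
    choose lam hlam hrow using hB
    have hrow' : ∀ s, ∀ i, ∑ t : Fin T, lam s t * rotCoef (cf s) t i = 0 := fun s i => by
      simpa [hM] using hrow s i
    -- the rotation-stable solution set and its indicator complement φ
    let Zc : (Fin n → Bool) → Prop := fun y => ∀ s, ∀ t < T, lform (cf s) (rot t y) = bv s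
    set φ : Smolensky.CubeFn (ZMod 3) n := fun y =>
      1 - ∏ s, ∏ t ∈ Finset.range T, (1 - (lform (cf s) (rot t y) - bv s) ^ 2) with hφ
    have hφval : ∀ y, φ y = if Zc y then 0 else 1 := by
      intro y
      have hin : ∀ s, ∏ t ∈ Finset.range T, (1 - (lform (cf s) (rot t y) - bv s) ^ 2) =
          if (∀ t ∈ Finset.range T, lform (cf s) (rot t y) - bv s = 0) then 1 else 0 :=
        fun s => prod_one_sub_sq _ _
      have e1 : φ y = 1 - ∏ s, ∏ t ∈ Finset.range T, (1 - (lform (cf s) (rot t y) - bv s) ^ 2) := by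
        rw [hφ]
      rw [e1, Finset.prod_congr rfl (fun s (_ : s ∈ univ) => hin s), Finset.prod_boole]
      by_cases hz : Zc y
      · rw [if_pos, if_pos hz, sub_self]
        intro s _ t ht
        exact sub_eq_zero.mpr (hz s t (Finset.mem_range.mp ht))
      · rw [if_neg, if_neg hz, sub_zero]
        intro h
        apply hz
        intro s t ht
        exact sub_eq_zero.mp (h s (mem_univ s) t (Finset.mem_range.mpr ht))
    have hφ1 : ∀ y, φ y = 1 ↔ ¬ Zc y := by
      intro y
      rw [hφval y]
      by_cases hz : Zc y
      · rw [if_pos hz]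
        exact ⟨fun h => absurd h (by decide), fun h => absurd hz h⟩
      · rw [if_neg hz]
        exact ⟨fun _ => hz, fun _ => rfl⟩
    have hZinv : ∀ y, Zc (rot 1 y) ↔ Zc y := fun y =>
      forall_congr' fun s => rotSys_invariant (cf s) (lam s) (hlam s) (hrow' s) (bv s) y
    refine ⟨φ, ?_, ?_, ?_, ?_⟩
    · -- degree ≤ S·T·2 ≤ L^{c₀+3}
      have hg : ∀ s : Fin S, ∀ t ∈ Finset.range T,
          (fun y => 1 - (lform (cf s) (rot t y) - bv s) ^ 2 : Smolensky.CubeFn (ZMod 3) n) ∈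
            Smolensky.lowDeg (ZMod 3) n 2 := fun s t _ => indFactor_mem_lowDeg _ _ _
      have hin : ∀ s ∈ (univ : Finset (Fin S)),
          (∏ t ∈ Finset.range T, (fun y => 1 - (lform (cf s) (rot t y) - bv s) ^ 2 :
            Smolensky.CubeFn (ZMod 3) n)) ∈ Smolensky.lowDeg (ZMod 3) n ((Finset.range T).card * 2) :=
        fun s _ => aff_prod_mem_lowDeg (Finset.range T) _ (hg s)
      have hout := aff_prod_mem_lowDeg univ _ hin
      rw [Finset.card_univ, Fintype.card_fin, Finset.card_range] at hout
      have e : φ = 1 - ∏ s, ∏ t ∈ Finset.range T,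
          (fun y => 1 - (lform (cf s) (rot t y) - bv s) ^ 2 : Smolensky.CubeFn (ZMod 3) n) := by
        funext y
        simp only [hφ, Pi.sub_apply, Pi.one_apply, Finset.prod_apply]
      rw [e]
      refine Smolensky.lowDeg_mono ?_ (Submodule.sub_mem _ (Smolensky.one_mem_lowDeg _) hout)
      calc S * (T * 2) ≤ L ^ c₀ * (L ^ 2 * L) := Nat.mul_le_mul hS (Nat.mul_le_mul hTL (by omega))
        _ = L ^ (c₀ + 3) := by ring
    · intro y
      by_cases hz : Zc y
      · rw [hφval, hφval, if_pos ((hZinv y).mpr hz), if_pos hz]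
      · rw [hφval, hφval, if_neg (fun h => hz ((hZinv y).mp h)), if_neg hz]
    · -- density: {φ = 1} = Zcᶜ and Zc ⊆ E
      have hZsubE : (univ.filter fun y => Zc y) ⊆ E := by
        intro y hy
        rw [mem_filter] at hy
        rw [hEdef]
        intro s
        have h := hy.2 s 0 (by omega)
        rwa [RingSymmetry.rot_zero] at h
      have hcardφ : (univ.filter fun y : Fin n → Bool => φ y = 1) = univ.filter fun y => ¬ Zc y := by
        ext y
        simp only [mem_filter, mem_univ, true_and, hφ1]
      have hsplit := Finset.card_filter_add_card_filter_not
        (s := (univ : Finset (Fin n → Bool))) (fun y => Zc y)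
      have hZE : ((univ.filter fun y => Zc y).card : ℝ) ≤ ηI * 2 ^ n :=
        le_trans (by exact_mod_cast Finset.card_le_card hZsubE) hE
      have hsplitR : ((univ.filter fun y => Zc y).card : ℝ) +
          ((univ.filter fun y : Fin n → Bool => ¬ Zc y).card : ℝ) = (2 : ℝ) ^ n := by
        rw [← hu]
        exact_mod_cast hsplit
      rw [hcardφ]
      linarith
    · -- nothing of Bad survives: Bad ⊆ Zc
      have hempty : (univ.filter fun y : Fin n → Bool => φ y = 1 ∧ ∀ t < T, rot t y ∈ E) = ∅ := by
        rw [Finset.filter_eq_empty_iff]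
        intro y _ h
        have hz : Zc y := fun s t ht => (hEdef _).mp (h.2 t ht) s
        exact ((hφ1 y).mp h.1) hz
      rw [hempty, Finset.card_empty, Nat.cast_zero]
      positivity


/-- **The workshop hinge `InvModCover3` RESTRICTED TO THE AFFINE-SYSTEM FAMILY holds** (statement = the hinge with the
test quantifier `∀ ψ ∈ lowDeg` replaced by `ψ := 1 − Π_s (1 − (ℓ_s(x|_{[0,n)}) − b_s)²)` for `S ≤ (log₂ n)^c` affine
forms over `𝔽₃`, every other quantifier verbatim; `η := η_I/64`, `m := 6`, words `W0`, `c₁ := 2`, `c' := c + 3`,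
consecutive rotations; from `invModCover3_affineCore`).  The family contains every adversary on record, in particular
the class-weight tests of part 12 / the critic's certificate that refute the strategy-free covering statement. -/
theorem steerDial_invModCover3Affine :
  ∀ ηI : ℝ, 0 < ηI → ∃ η : ℝ, 0 < η ∧ ∀ k' : ℕ, ∃ m : ℕ, 1 ≤ m ∧ ∃ c₁ : ℕ, ∀ c : ℕ, ∃ c' : ℕ, ∃ n₀ : ℕ,
    ∀ n ≥ n₀, ∀ S : ℕ, S ≤ (Nat.log 2 n) ^ c → ∀ (cf : Fin S → Fin n → ZMod 3) (bv : Fin S → ZMod 3),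
    ∀ ψ : Smolensky.CubeFn (ZMod 3) (n + m),
      (∀ x, ψ x = 1 - ∏ s, (1 - (lform (cf s) (fun i => x (Fin.castAdd m i)) - bv s) ^ 2)) →
      (1 - η) * (2 : ℝ) ^ (n + m) ≤ ((univ.filter fun x : Fin (n + m) → Bool => ψ x = 1).card : ℝ) →
        ∃ T : ℕ, T ≤ (Nat.log 2 n) ^ c₁ ∧ ∃ r : Fin T → ℕ, ∃ u α β : Fin T → Fin m → Bool,
          ∃ a b : Fin T → Bool, (∀ t, wordCert (u t) (α t) (β t) (a t) (b t) = true) ∧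
          ∃ φ : Smolensky.CubeFn (ZMod 3) n, φ ∈ Smolensky.lowDeg (ZMod 3) n ((Nat.log 2 n) ^ c') ∧
            (∀ y : Fin n → Bool, φ (rot 1 y) = φ y) ∧
            (1 - ηI) * (2 : ℝ) ^ n ≤ ((univ.filter fun y : Fin n → Bool => φ y = 1).card : ℝ) ∧
            ((univ.filter fun y : Fin n → Bool =>
                φ y = 1 ∧ ∀ t : Fin T, ψ (pad (u t) (rot (r t) y)) ≠ 1).card : ℝ) ≤
              1 / (n : ℝ) ^ k' * (2 : ℝ) ^ n := by
  classical
  intro ηI hηI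
  refine ⟨ηI / 64, by positivity, fun k' => ⟨6, by norm_num, 2, fun c => ⟨c + 3, ?_⟩⟩⟩
  obtain ⟨n₀, hcore⟩ := invModCover3_affineCore ηI k' c
  refine ⟨n₀, ?_⟩
  intro n hn S hS cf bv ψ hψ hdens
  set E : Finset (Fin n → Bool) := univ.filter fun y => ∀ s, lform (cf s) y = bv s with hE
  have hEdef : ∀ y, y ∈ E ↔ ∀ s, lform (cf s) y = bv s := fun y => by simp [hE]
  have hψne : ∀ x, ψ x ≠ 1 ↔ ∀ s, lform (cf s) (fun i => x (Fin.castAdd 6 i)) = bv s := by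
    intro x
    rw [hψ x, prod_one_sub_sq]
    by_cases h : ∀ s ∈ (univ : Finset (Fin S)), lform (cf s) (fun i => x (Fin.castAdd 6 i)) - bv s = 0
    · rw [if_pos h, sub_self]
      exact ⟨fun _ s => sub_eq_zero.mp (h s (mem_univ s)), fun _ => by decide⟩
    · rw [if_neg h, sub_zero]
      exact ⟨fun h1 => absurd rfl h1, fun h2 => absurd (fun s _ => sub_eq_zero.mpr (h2 s)) h⟩
  have hEcard : (E.card : ℝ) ≤ ηI * 2 ^ n := by
    have h1 : E.card ≤ (univ.filter fun x : Fin (n + 6) → Bool => ψ x ≠ 1).card := by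
      refine Finset.card_le_card_of_injOn (pad W0) (fun z hz => ?_) (fun z _ z' _ hzz => ?_)
      · simp only [mem_coe, mem_filter, mem_univ, true_and] at hz ⊢
        rw [hψne]
        have hb : (fun i => pad W0 z (Fin.castAdd 6 i)) = z := funext fun i => pad_castAdd W0 z i
        rw [hb]
        exact (hEdef z).mp hz
      · funext i
        have := congrFun hzz (Fin.castAdd 6 i)
        simpa [pad_castAdd] using this
    have h2 := Finset.card_filter_add_card_filter_not (s := (univ : Finset (Fin (n + 6) → Bool)))
      (fun x => ψ x = 1)
    have hu : (univ : Finset (Fin (n + 6) → Bool)).card = 2 ^ (n + 6) := by simp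
    rw [hu] at h2
    have h3 : ((univ.filter fun x : Fin (n + 6) → Bool => ψ x = 1).card : ℝ) +
        ((univ.filter fun x : Fin (n + 6) → Bool => ¬ ψ x = 1).card : ℝ) = (2 : ℝ) ^ (n + 6) := by
      exact_mod_cast h2
    have h4 : (E.card : ℝ) ≤ ((univ.filter fun x : Fin (n + 6) → Bool => ¬ ψ x = 1).card : ℝ) := by
      exact_mod_cast h1
    have h5 : (2 : ℝ) ^ (n + 6) = 2 ^ n * 64 := by rw [pow_add]; norm_num
    rw [h5] at h3 hdens
    nlinarith
  obtain ⟨T, _, hTL, φ, hdeg, hinv, hdense, hbad⟩ := hcore n hn S hS cf bv E hEdef hEcard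
  refine ⟨T, hTL, fun t => t.val, fun _ => W0, fun _ => A0, fun _ => B0, fun _ => false, fun _ => false,
    fun _ => wordCert_W0, φ, hdeg, hinv, hdense, ?_⟩
  have hset : (univ.filter fun y : Fin n → Bool => φ y = 1 ∧ ∀ t : Fin T, ψ (pad W0 (rot t.val y)) ≠ 1) =
      (univ.filter fun y : Fin n → Bool => φ y = 1 ∧ ∀ t < T, rot t y ∈ E) := by
    ext y
    simp only [mem_filter, mem_univ, true_and]
    refine and_congr_right fun _ => ?_
    constructor
    · intro h t ht
      rw [hEdef]
      have h1 := (hψne _).mp (h ⟨t, ht⟩)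
      have hb : (fun i => pad W0 (rot t y) (Fin.castAdd 6 i)) = rot t y := funext fun i => pad_castAdd W0 _ i
      rwa [hb] at h1
    · intro h t
      rw [hψne]
      have hb : (fun i => pad W0 (rot t.val y) (Fin.castAdd 6 i)) = rot t.val y :=
        funext fun i => pad_castAdd W0 _ i
      rw [hb]
      exact (hEdef _).mp (h t.val t.is_lt)
  dsimp only
  rw [hset]
  exact hbad

end AffineCore

end Summit.QuantumAdvantage.QuantumAdvantage.Theorems.SteerDial
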